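import Literature.Probability.Percolation.GladkovThreeClusterDichotomyProofs
import Literature.Probability.Percolation.KozmaNitzanHittable
import Summits.CriticalPhenomena.PercolationContinuityZ3.Theorems.PercNearOneGluingNoHeavyLowerTailThreePointHalvingTransplant
import HarnessLib

/-!
# The halving lemma (v) holds at two of the three apexes of every triple (Sahi programme, prover prim-sahi-p2 gen 48)

Support file (`--supports stmt-CriticalPhenomena-4575`, helper).  No definitions, no named facts, no sorries; standard axioms.
Memo `run/shared/lean/prim/prim-sahi/FROM-prim-sahi-p2-gen48-HYBRIDS.md`; `prim-sahi-p2/PROOF-E3.md` §58.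

SETTING.  Bernoulli bond percolation `μ = prodBernoulli w` with arbitrary pair weights on a finite vertex type; three vertices `s, a, c`
(`a` the apex); cells `T = μ(sac)`, `p₁ = μ(sa|c)`, `p₂ = μ(ac|s)`, `p₃ = μ(sc|a)`, `p₀ = μ(s|a|c)`; `U = {s↔a} ∪ {c↔a}`, `D = {s↮c}`,
`X = U ∩ D` (so `μ(X) = p₁ + p₂`), `I = Uᶜ` (so `μ(I) = p₀ + p₃`).  The HALVING LEMMA (v) of this line is `μ(U)·μ(D) ≤ 2·μ(U ∩ D)`,
equivalently `T·p₀ ≤ (1 + p₃)(p₁ + p₂)`, equivalently `μ{s↔c}·μ(I) ≤ p₁ + p₂ + p₃` (the LINEAR form of Gladkov's three-cluster dichotomy,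
arXiv:2408.08457 Thm. 1.3); it is OPEN in general.

WHAT IS PROVED (every finite weighted graph, all vertices).
* `halvingUD_of_pairSep_le` — **(v) holds at the apex `a` as soon as `p₃ ≤ p₁ + p₂`**, i.e. `μ(sc|a) ≤ μ(sa|c) + μ(ac|s)`.
  Proof: Gladkov–Zimin's three-point inequality `μ(I)·μ(U) ≤ p₁ + p₂ + p₃` (arXiv:2404.08873 Thm. 4.6, tree
  `gladkovZimin2024_threePoint_prodBernoulli`, proved there by Gladkov's decision-tree swap (Lemma 3.1) and the boundary-dart lemma (Lemma 7.1))
  and the cell algebra `μ(U)μ(D) − 2μ(X) = μ{s↔c}·μ(I) − (p₁+p₂+p₃)` with `μ{s↔c} = T + p₃ ≤ T + p₁ + p₂ = μ(U)` under the hypothesis.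
* `halving_cells_of_pairSep_le` — the same in cell form `T·p₀ ≤ (1 + p₃)(p₁ + p₂)`.
* **`halvingUD_apex_a_or_apex_s`** — for EVERY weighted graph and every `s, a, c`, (v) holds at the apex `a` OR at the apex `s`
  (because `μ(sc|a) > μ(sa|c) + μ(ac|s)` and `μ(ac|s) > μ(as|c) + μ(sc|a)` cannot both hold); hence (v) holds for at least two of the three
  apex choices of every triple, and the only possibly-open case at a triple is the apex whose opposite pair-separation cell exceeds the
  sum of the other two.
Nothing here asserts (v) in general.  (Gen 43's independence check of (v) against the printed three-point rows, PROOF-E3 (53f), did not include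
GZ24 Thm. 4.6; its violating pseudo-law has `p₃ = 0.381 > p₁ + p₂ = 0.0115`, consistent with the present file.)
[cite: GladkovZimin2024, Thm. 4.6 (arXiv:2404.08873)]; [cite: Gladkov2024, Lemma 3.1, Lemma 7.1, Thm. 1.3 (arXiv:2408.08457)].
-/

noncomputable section

open Classical

namespace Summit.CriticalPhenomena.PercolationContinuityZ3.Theorems

namespace HalvingTwoOfThree

open MeasureTheory
open Literature.Probability.Percolation Literature.Probability.LatticeModels

variable {V : Type*} [Fintype V]

omit [Fintype V] in
/-- `{s↔a} ∩ {c↔a}ᶜ = {s↔a} ∩ {s↔c}ᶜ` (the cell `sa|c`). [folklore] -/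
theorem sa_inter_compl_ca (s a c : V) :
    (openConn s a ∩ (openConn c a)ᶜ : Set (BondConfig V)) = openConn s a ∩ (openConn s c)ᶜ := by
  ext ω
  simp only [Set.mem_inter_iff, Set.mem_compl_iff, openConn, Set.mem_setOf_eq]
  constructor
  · rintro ⟨h, hca⟩; exact ⟨h, fun hsc => hca (hsc.symm.trans h)⟩
  · rintro ⟨h, hsc⟩; exact ⟨h, fun hca => hsc (h.trans hca.symm)⟩

omit [Fintype V] in
/-- `{c↔a} ∩ {s↔a}ᶜ = {c↔a} ∩ {c↔s}ᶜ` (the cell `ac|s`). [folklore] -/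
theorem ca_inter_compl_sa (s a c : V) :
    (openConn c a ∩ (openConn s a)ᶜ : Set (BondConfig V)) = openConn c a ∩ (openConn c s)ᶜ :=
  sa_inter_compl_ca c a s

omit [Fintype V] in
/-- `{s↔a}ᶜ ∩ {c↔a}ᶜ ∩ {s↔c} = {s↔c} ∩ {s↔a}ᶜ` (the cell `sc|a`). [folklore] -/
theorem I_inter_sc (s a c : V) :
    ((openConn s a)ᶜ ∩ (openConn c a)ᶜ ∩ openConn s c : Set (BondConfig V)) = openConn s c ∩ (openConn s a)ᶜ := by
  ext ω
  simp only [Set.mem_inter_iff, Set.mem_compl_iff, openConn, Set.mem_setOf_eq]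
  constructor
  · rintro ⟨⟨hsa, -⟩, hsc⟩; exact ⟨hsc, hsa⟩
  · rintro ⟨hsc, hsa⟩; exact ⟨⟨hsa, fun hca => hsa (hsc.trans hca)⟩, hsc⟩

omit [Fintype V] in
/-- `{s↔a}ᶜ ∩ {c↔a}ᶜ ∩ {s↔c}ᶜ = {s↔a}ᶜ ∩ {s↔c}ᶜ ∩ {c↔a}ᶜ` (the cell `s|a|c`, reordered). [folklore] -/
theorem I_diff_sc (s a c : V) :
    (((openConn s a)ᶜ ∩ (openConn c a)ᶜ) \ openConn s c : Set (BondConfig V)) =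
      (openConn s a)ᶜ ∩ (openConn s c)ᶜ ∩ (openConn c a)ᶜ := by
  ext ω
  simp only [Set.mem_sdiff, Set.mem_inter_iff, Set.mem_compl_iff]
  tauto

/-- **Gladkov–Zimin's three-point inequality in the `s, a, c` vocabulary of this line**:
`μ(I)·μ(U) ≤ μ(sa|c) + μ(ac|s) + μ(sc|a)` with `U = {s↔a} ∪ {c↔a}`, `I = {s↔a}ᶜ ∩ {c↔a}ᶜ`.
[cite: GladkovZimin2024, Thm. 4.6 (arXiv:2404.08873), tree `gladkovZimin2024_threePoint_prodBernoulli`] -/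
theorem I_mul_U_le_twoBlocks (w : Sym2 V → unitInterval) (s a c : V) :
    (prodBernoulli w).real ((openConn s a)ᶜ ∩ (openConn c a)ᶜ) * (prodBernoulli w).real (openConn s a ∪ openConn c a) ≤
      (prodBernoulli w).real (openConn s a ∩ (openConn s c)ᶜ) + (prodBernoulli w).real (openConn c a ∩ (openConn c s)ᶜ) +
        (prodBernoulli w).real (openConn s c ∩ (openConn s a)ᶜ) := by
  have h := gladkovZimin2024_threePoint_prodBernoulli w a s c
  rw [openConn_comm a s, openConn_comm a c, sa_inter_compl_ca, ca_inter_compl_sa, I_inter_sc] at h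
  exact h

/-- **(v) AT THE APEX `a` WHENEVER `μ(sc|a) ≤ μ(sa|c) + μ(ac|s)`**: then `μ(U)·μ(D) ≤ 2·μ(U ∩ D)`, `U = {s↔a} ∪ {c↔a}`, `D = {s↮c}`.
From Gladkov–Zimin Thm. 4.6 and the cell algebra `μ(U)μ(D) − 2μ(U∩D) = μ{s↔c}·μ(I) − (p₁+p₂+p₃)`, `μ{s↔c} = T + p₃`, `μ(U) = T + p₁ + p₂`.
[cite: GladkovZimin2024, Thm. 4.6] [this work] -/
theorem halvingUD_of_pairSep_le (w : Sym2 V → unitInterval) (s a c : V)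
    (h3 : (prodBernoulli w).real (openConn s c ∩ (openConn s a)ᶜ) ≤
      (prodBernoulli w).real (openConn s a ∩ (openConn s c)ᶜ) + (prodBernoulli w).real (openConn c a ∩ (openConn c s)ᶜ)) :
    (prodBernoulli w).real (openConn s a ∪ openConn c a) * (prodBernoulli w).real ((openConn s c)ᶜ) ≤
      2 * (prodBernoulli w).real ((openConn s a ∪ openConn c a) ∩ (openConn s c)ᶜ) := by
  have hGZ := I_mul_U_le_twoBlocks w s a c
  set μ := prodBernoulli w with hμ
  -- cell decompositions
  have hX : μ.real ((openConn s a ∪ openConn c a) ∩ (openConn s c)ᶜ) =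
      μ.real (openConn s a ∩ (openConn s c)ᶜ) + μ.real (openConn c a ∩ (openConn c s)ᶜ) := by
    rw [HalvingTransplant.inter_D_eq_union, measureReal_union (HalvingTransplant.disjoint_pairSep s a c) MeasurableSet.of_discrete]
  have hUc : μ.real (openConn s a ∪ openConn c a) = 1 - μ.real ((openConn s a)ᶜ ∩ (openConn c a)ᶜ) := by
    rw [← Set.compl_union, measureReal_compl MeasurableSet.of_discrete, probReal_univ]
    ring
  have hI : μ.real ((openConn s a)ᶜ ∩ (openConn c a)ᶜ) =
      μ.real (openConn s c ∩ (openConn s a)ᶜ) + μ.real ((openConn s a)ᶜ ∩ (openConn s c)ᶜ ∩ (openConn c a)ᶜ) := by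
    rw [← I_diff_sc s a c, ← I_inter_sc s a c, Set.inter_comm ((openConn s a)ᶜ ∩ (openConn c a)ᶜ) (openConn s c),
      ← Set.inter_comm ((openConn s a)ᶜ ∩ (openConn c a)ᶜ) (openConn s c)]
    rw [show ((openConn s a)ᶜ ∩ (openConn c a)ᶜ ∩ openConn s c : Set (BondConfig V)) =
        ((openConn s a)ᶜ ∩ (openConn c a)ᶜ) ∩ openConn s c from rfl]
    exact (measureReal_inter_add_sdiff₀ (μ := μ) (s := (openConn s a)ᶜ ∩ (openConn c a)ᶜ) (t := openConn s c)
      (MeasurableSet.of_discrete).nullMeasurableSet).symm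
  have hD : μ.real ((openConn s c)ᶜ) =
      μ.real ((openConn s a ∪ openConn c a) ∩ (openConn s c)ᶜ) + μ.real ((openConn s a)ᶜ ∩ (openConn s c)ᶜ ∩ (openConn c a)ᶜ) := by
    rw [← HalvingTransplant.D_diff_U_eq_Z0 s a c, Set.inter_comm (openConn s a ∪ openConn c a),
      ← measureReal_inter_add_sdiff₀ (μ := μ) (s := (openConn s c)ᶜ) (t := openConn s a ∪ openConn c a)
      (MeasurableSet.of_discrete).nullMeasurableSet]
    congr 2
  -- algebra: with I = μ(I), X = μ(U ∩ D), P0 = μ(s|a|c), P3 = μ(sc|a):  I = P3 + P0, μ(U) = 1 - I, μ(D) = X + P0,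
  -- GZ: I (1 - I) ≤ X + P3, h3: P3 ≤ X  ⟹  (1 - I)(X + P0) ≤ 2X.
  set X := μ.real ((openConn s a ∪ openConn c a) ∩ (openConn s c)ᶜ)
  set I := μ.real ((openConn s a)ᶜ ∩ (openConn c a)ᶜ)
  set P0 := μ.real ((openConn s a)ᶜ ∩ (openConn s c)ᶜ ∩ (openConn c a)ᶜ)
  set P3 := μ.real (openConn s c ∩ (openConn s a)ᶜ)
  have hI0 : 0 ≤ I := measureReal_nonneg
  rw [hUc, hD]
  rw [hUc] at hGZ
  have h3' : P3 ≤ X := by rw [hX]; exact h3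
  have hGZ' : I * (1 - I) ≤ X + P3 := by rw [hX]; linarith
  have hprod : 0 ≤ I * (X - P3) := mul_nonneg hI0 (sub_nonneg.2 h3')
  nlinarith [hGZ', hprod, hI, h3']

/-- **Cell form**: `T·p₀ ≤ (1 + p₃)·(p₁ + p₂)` whenever `p₃ ≤ p₁ + p₂`, with `T = μ({s↔a} ∩ {s↔c})`, `p₀ = μ(s|a|c)`,
`p₁ = μ({s↔a} ∖ {s↔c})`, `p₂ = μ({c↔a} ∖ {c↔s})`, `p₃ = μ({s↔c} ∖ {s↔a})`. [cite: GladkovZimin2024, Thm. 4.6] [this work] -/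
theorem halving_cells_of_pairSep_le (w : Sym2 V → unitInterval) (s a c : V)
    (h3 : (prodBernoulli w).real (openConn s c ∩ (openConn s a)ᶜ) ≤
      (prodBernoulli w).real (openConn s a ∩ (openConn s c)ᶜ) + (prodBernoulli w).real (openConn c a ∩ (openConn c s)ᶜ)) :
    (prodBernoulli w).real (openConn s a ∩ openConn s c) *
        (prodBernoulli w).real ((openConn s a)ᶜ ∩ (openConn s c)ᶜ ∩ (openConn c a)ᶜ) ≤
      (1 + (prodBernoulli w).real (openConn s c ∩ (openConn s a)ᶜ)) *
        ((prodBernoulli w).real (openConn s a ∩ (openConn s c)ᶜ) + (prodBernoulli w).real (openConn c a ∩ (openConn c s)ᶜ)) := by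
  set μ := prodBernoulli w with hμ
  have hUD := halvingUD_of_pairSep_le w s a c h3
  have hX : μ.real ((openConn s a ∪ openConn c a) ∩ (openConn s c)ᶜ) =
      μ.real (openConn s a ∩ (openConn s c)ᶜ) + μ.real (openConn c a ∩ (openConn c s)ᶜ) := by
    rw [HalvingTransplant.inter_D_eq_union, measureReal_union (HalvingTransplant.disjoint_pairSep s a c) MeasurableSet.of_discrete]
  have hU : μ.real (openConn s a ∪ openConn c a) =
      μ.real ((openConn s a ∪ openConn c a) ∩ (openConn s c)ᶜ) + μ.real (openConn s a ∩ openConn s c) := by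
    rw [← HalvingTransplant.inter_Dc_eq_J s a c,
      ← measureReal_inter_add_sdiff₀ (μ := μ) (s := openConn s a ∪ openConn c a) (t := (openConn s c)ᶜ)
      (MeasurableSet.of_discrete).nullMeasurableSet]
    congr 2
    ext ω; simp only [Set.mem_sdiff, Set.mem_compl_iff, not_not, Set.mem_inter_iff]
  have hD : μ.real ((openConn s c)ᶜ) =
      μ.real ((openConn s a ∪ openConn c a) ∩ (openConn s c)ᶜ) + μ.real ((openConn s a)ᶜ ∩ (openConn s c)ᶜ ∩ (openConn c a)ᶜ) := by
    rw [← HalvingTransplant.D_diff_U_eq_Z0 s a c, Set.inter_comm (openConn s a ∪ openConn c a),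
      ← measureReal_inter_add_sdiff₀ (μ := μ) (s := (openConn s c)ᶜ) (t := openConn s a ∪ openConn c a)
      (MeasurableSet.of_discrete).nullMeasurableSet]
    congr 2
  have hDc : μ.real ((openConn s c)ᶜ) =
      1 - (μ.real (openConn s a ∩ openConn s c) + μ.real (openConn s c ∩ (openConn s a)ᶜ)) := by
    rw [measureReal_compl MeasurableSet.of_discrete, probReal_univ]
    congr 1
    conv_lhs => rw [HalvingTransplant.openConn_eq_J_union_SC s a c]
    rw [measureReal_union _ MeasurableSet.of_discrete]
    rw [Set.disjoint_left]
    rintro ω ⟨hsa, -⟩ ⟨-, hna⟩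
    exact hna hsa
  set X := μ.real ((openConn s a ∪ openConn c a) ∩ (openConn s c)ᶜ)
  set T := μ.real (openConn s a ∩ openConn s c)
  set P0 := μ.real ((openConn s a)ᶜ ∩ (openConn s c)ᶜ ∩ (openConn c a)ᶜ)
  set P3 := μ.real (openConn s c ∩ (openConn s a)ᶜ)
  have hX0 : 0 ≤ X := measureReal_nonneg
  rw [← hX]
  rw [hU, hD] at hUD
  have hD' : X + P0 = 1 - (T + P3) := by rw [← hD, hDc]
  nlinarith [hUD, hX0, hD']

/-- **(v) HOLDS AT THE APEX `a` OR AT THE APEX `s`** (every finite weighted graph, all `s a c`): the hypotheses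
`μ(sc|a) > μ(sa|c) + μ(ac|s)` and `μ(ac|s) > μ(as|c) + μ(sc|a)` of the two failures are incompatible.  Consequently (v) holds for at least
two of the three apex choices of every triple. [cite: GladkovZimin2024, Thm. 4.6] [this work] -/
theorem halvingUD_apex_a_or_apex_s (w : Sym2 V → unitInterval) (s a c : V) :
    (prodBernoulli w).real (openConn s a ∪ openConn c a) * (prodBernoulli w).real ((openConn s c)ᶜ) ≤
        2 * (prodBernoulli w).real ((openConn s a ∪ openConn c a) ∩ (openConn s c)ᶜ) ∨
      (prodBernoulli w).real (openConn a s ∪ openConn c s) * (prodBernoulli w).real ((openConn a c)ᶜ) ≤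
        2 * (prodBernoulli w).real ((openConn a s ∪ openConn c s) ∩ (openConn a c)ᶜ) := by
  set μ := prodBernoulli w with hμ
  by_cases h : μ.real (openConn s c ∩ (openConn s a)ᶜ) ≤
      μ.real (openConn s a ∩ (openConn s c)ᶜ) + μ.real (openConn c a ∩ (openConn c s)ᶜ)
  · exact Or.inl (halvingUD_of_pairSep_le w s a c h)
  · right
    refine halvingUD_of_pairSep_le w a s c ?_
    rw [not_le] at h
    -- `μ(ac|s) ≤ μ(sc|a) ≤ μ(as|c) + μ(cs|a)`
    have e1 : (openConn a c ∩ (openConn a s)ᶜ : Set (BondConfig V)) = openConn c a ∩ (openConn c s)ᶜ := by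
      rw [openConn_comm a c, openConn_comm a s, ca_inter_compl_sa]
    have e2 : (openConn c s ∩ (openConn c a)ᶜ : Set (BondConfig V)) = openConn s c ∩ (openConn s a)ᶜ := by
      ext ω
      simp only [Set.mem_inter_iff, Set.mem_compl_iff, openConn, Set.mem_setOf_eq]
      constructor
      · rintro ⟨h1, h2⟩; exact ⟨h1.symm, fun hsa => h2 (h1.trans hsa)⟩
      · rintro ⟨h1, h2⟩; exact ⟨h1.symm, fun hca => h2 (h1.trans hca)⟩
    rw [e1, e2]
    have h0 : 0 ≤ μ.real (openConn a s ∩ (openConn a c)ᶜ) := measureReal_nonneg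
    have h1 : 0 ≤ μ.real (openConn s a ∩ (openConn s c)ᶜ) := measureReal_nonneg
    linarith

end HalvingTwoOfThree

end Summit.CriticalPhenomena.PercolationContinuityZ3.Theorems

end
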